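import Literature.MathematicalPhysics.QuantumFieldTheory.Balaban1983to89.B5Eq165GaugeMinimaV1
import Literature.MathematicalPhysics.QuantumFieldTheory.Balaban1983to89.B5Eq117FibreVolume
import Literature.MathematicalPhysics.QuantumFieldTheory.Balaban1983to89.B5ChangeOfGauge123
import Literature.MathematicalPhysics.QuantumFieldTheory.Balaban1983to89.B5GaussSectC

/-!
# `Balaban1983to89.B5Eq123ChangeOfGaugeV1` — T. Bałaban, *Propagators and renormalization transformations for lattice gauge theories. I*,
Commun. Math. Phys. **95** (1984) 17–40 [Balaban1984PropagatorsI], Sect. C pp. 21–22: the Faddeev–Popov unit (1.22), the CHANGE OF GAUGE (1.23),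
the Gaussian orbit integral (1.24) and the density (1.27), PROVED ON THE V1 LATTICE CALCULUS (`LatticeFieldCalculus`) for the `k`-fold
transformation `(ST)^k` of `B5Eq112RenormTransf`/`B5Eq117CompositionV1` — and identified with [BalabanImbrieJaffe1985] (4.4.1)–(4.4.3):
`((ST)^k e^{−S})(B) = z′^{(k)}·Z_k(B)`

statement-level skeleton of published theorems with citation tags; proofs where landed; nothing here is a claim about the Yang–Mills mass gap

PDF held: `paper:balaban1984-cmp95-propagators-rt-i` (journal page = PDF page + 16): pp. 20–22 [PDF 4–6] ((1.17)–(1.28)), p. 25 [PDF 9], p. 29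
[PDF 13] from the materialised text; the displays (1.22)–(1.24) were re-read on the cell's page render
`run/shared/lean/pub/pub-balaban/b2b-balaban-ref1/pages/1984-cmp95-propagators-rt-I/…-p005-x2.png` (the OCR of p. 21 is unusable for them).
[BalabanImbrieJaffe1985] = T. Bałaban, J. Imbrie, A. Jaffe, *Renormalization of the Higgs model: minimizers, propagators and the stability of mean
field theory*, Commun. Math. Phys. **97** (1985) 299–329, Sect. 4.4 pp. 311–312 (its objects are used BY NAME from seat p11's files, not re-read).

PRINT (p. 21 [PDF 5], verbatim).  «We want to remove the second term in the action by a gauge fixing term, so we introduce under the integral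
(1.17) the identity  1 = ∫dλ′ δ(Q′_kλ′) exp(−(1/2α)⟨∂*A^{λ′}, ∂*A^{λ′}⟩) / ∫dλ δ(Q′_kλ) exp(−(1/2α)⟨∂*A^λ, ∂*A^λ⟩).  (1.22)  The restrictions on
the gauge transformations given by the δ-functions above are chosen in such a way that all the expressions in the integral (1.17) with the
exception of gauge fixing terms δ_Ax are invariant. Next we will calculate the expression in the numerator and denominator above and we will see
that it is different from 0, but now let us transform (1.17). We change the order of integrations ∫dA∫dλ′…, and we make the gauge transformation
−λ′ in the integral ∫dA…. We change the order of integrations again and we make a translation λ → λ + λ′ in the integral ∫dλ…. We get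
(1.17) = z^{(k)}∫dA δ(B − Q_kA)(∫dλ′ δ(Q′_kλ′)·δ_Ax(Q_{k−1}A + ∂^{L^{−1}}Q′_{k−1}λ′)·…·δ_Ax(A + ∂^ηλ′))·exp(−(1/2α)⟨∂*A, ∂*A⟩)
(∫dλ δ(Q′_kλ) exp(−(1/2α)⟨∂*A^λ, ∂*A^λ⟩))⁻¹ e^{−S^η(A)} = z′^{(k)}∫dA δ(B − Q_kA) exp(−(1/2α)⟨∂*A, ∂*A⟩)·(∫dλ δ(Q′_kλ) exp(−(1/2α)⟨∂*A^λ,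
∂*A^λ⟩))⁻¹ e^{−S^η(A)}.  (1.23)  Now we will calculate the integral inside the above expression:  ∫dλ δ(Q′_kλ) exp(−(1/2α)‖∂*A − Δλ‖²) = …
exp(−(1/2α) inf_{λ:Q′_kλ=0}‖∂*A − Δλ‖²)  (1.24)»; p. 22 «We have finally  exp(−(1/2α)⟨∂*A,∂*A⟩)(∫dλ δ(Q′_kλ)exp(−(1/2α)⟨∂*A^λ,∂*A^λ⟩))⁻¹ =
(…)⁻¹ exp(−(1/2α)⟨∂*A, (I − Δ⁻¹Q′*_k(Q′_kΔ⁻²Q′*_k)⁻¹Q′_kΔ⁻¹)∂*A⟩)  (1.27)»; p. 25 l. 1 «from its definition it follows that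
∫dλ δ(Q′_kλ)𝒢_α(∂*A^λ) = 1»; p. 29 «(1.47) = Z_k exp(−½⟨∂H_kB, ∂H_kB⟩).  (1.64)».

CITATION HEADER (lean-in-tree rule) — WHAT IS REPRODUCED.  Phase-2 proof file of the lit-balaban typed skeleton (HOME
`run/shared/lean/pub/lit-balaban/`), seat p38 (gen 3), for the typed-not-proved r18 row **B5.Eq1.21-1.24** (X04: «Feynman-type gauge via
Faddeev–Popov: insert 1 = …; gauge-fixing form (1/2α)⟨∂*A,∂*A⟩»; its FORM is r18's `LatticeFieldCalculus.divergenceForm` p239006, its IDENTITY was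
«typed-abstract») and a V1 TWIN of the B5 owner's row **B5.Eq1.23** (torus carrier: typed `B5SectBStatements.Eq123` r02, PROVED `B5Eq123Torus.eq123_holds`
p37; mechanism of record `B5ChangeOfGauge123.eq123` p22 — all untouched), ON THE CROSS-PAPER CARRIERS OF RECORD: `LatticeFieldCalculus` (r18: `grad`,
`diverg`, `laplace`, `gaugeShift` (1.4), `siteAvgIter` = Q′_k (1.20), `bondAvgIter` = Q_k (1.18), `IsAxial` = δ_Ax (1.10), `curlAction` (1.3),
`divergenceForm` (1.22)), `B5Eq112RenormTransf.renormTransf` (p16, (1.12)) and its `k`-fold iterate `B5Eq117CompositionV1.rtPow`/`multiRT` (p38 gen 2,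
(1.17)), the V1 hierarchical axial gauge `B5HierAxialGaugeV1.hierAxial_exists`/`kernel_trivial` (p37), the V1 instance `opsV1 P k c s` of
[BalabanImbrieJaffe1985] Sect. 4.4 with `fibInt`/`fpDen`/`calG`/`weight`/`Zk`/`Hk` (p11, `BIJ85LandauForm441`/`BIJ85LandauMinimizer442(V1)`), BIJ85's
direction space `V411` (p09) and the Gaussian engine of Sect. C `B5GaussSectC` (β cell: `gaussW`, `ZN`, `Rop`, `calG`, `integral_124`) — BY NAME,
nothing re-declared.  New definitions here are coordinates/abbreviations only (`SiteSpace`, `resid` = N(Q′_k), `fdir` = N(Q_k), `phiFun`/`phi`/`coords`,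
the (1.22) integral `fp22`, the (1.23) weight `fpWeight` and integral `rt23`); no `Prop`-valued fact is introduced.

WHAT IS PROVED (kernel; axioms `propext`/`Classical.choice`/`Quot.sound`; standing range `k ≤ m + K` of `Setup.Params`, lattice factor `c ≠ 0`).
§1 `coords hk hc : (V411 × N(Q′_k)) ≃L N(Q_k)`, `(m, λ) ↦ m − ∂λ` — slice ⊕ residual-orbit coordinates of the fibre directions (injective =
   `kernel_trivial`, surjective = `hierAxial_exists`, into `N(Q_k)` by (1.20) `Q_k∂λ = ∂Q′_kλ = 0`).
§2 (1.22)/(1.24)/(1.27) on V1: `fp22_eq_124` ((1.24): `∫dλ δ(Q′_kλ)e^{−(1/2α)Σ_x w|∂*A − Δλ|²} = Z_N·γ(∂*A − R∂*A)`), **`fp22_pos`** ((1.22)'s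
   denominator `> 0` for every field, `w > 0`, `α > 0` — «Δ is positive definite on N(Q′_k)» on V1 = `lapInjective_V1` of p11 ⟸ `B5Positivity172Lattice`),
   `eq122`, `weight_eq_calG` ((1.27): the (1.23) weight is `𝒢_α(∂*A)`), `integral_weight_eq_one` (p. 25 l. 1).
§3 **`multiRT_eq_rt23`** — (1.23) for densities: ONE `z > 0` (the Jacobian of `coords`) with `∫dA δ(B − Q_kA)δ_Ax(Q_{k−1}A)⋯δ_Ax(A)ρ(A) = z·rt23 k w c α ρ B`
   for every `w > 0`, `α > 0`, every continuous `ρ ≥ 0` invariant under `A ↦ A^λ`, `λ ∈ N(Q′_k)`, every `B`; `rt23` = the printed right-hand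
   integral over `{Q_kA = B}` (= p11's `fibInt` for every base point, `rt23_eq_fibInt`).  The proof is p22's kernel of the printed manipulation
   (`B5ChangeOfGauge123.eq123_zprime`) fed with §1–§2.
§4 **`eq123`** — (1.23) AS PRINTED for `(ST)^k e^{−S}`, `S = curlAction w c`: ONE `z′^{(k)} > 0` for ALL `α > 0` and all `B` (with gen-2's (1.17)
   `eq117_curlAction`); `rt23_eq_rt23` (the (1.23) integral is independent of `α`); the DICTIONARY `fpWeight_mul_exp_eq_weight`/`rt23_eq_Zk` (the
   (1.23) integrand/integral at BIJ85's normalisation = p11's `weight`/`Zk` of (4.4.3)); **`eq123_Zk`**: `((ST)^k e^{−S})(B) = z′^{(k)}·Z_k(B)`;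
   **`Zk_eq_exp`** — (1.64) on V1 for this integral: `Z_k(B) = C·exp(−½‖∂H_kB‖²)`, `H_k` the Landau minimizer (4.4.2) (from (1.19) on V1
   `B5Eq119GaussianV1.eq119` and (1.65) `B5Eq165GaugeMinimaV1.eq165_landau`); `torusZax_eq_const_mul_Zk` (`Z_{k,Ax}(B) = C·Z_k(B)`).

READINGS (none is an objection to print).  (a) δ-functions of LINEAR constraints = volume measures of the constraint subspaces of the Euclidean
bond- and site-function spaces (the paper's own reading (1.40) p. 25; convention of `B5GaussSectC`, `B5Eq112RenormTransf`, `B5ChangeOfGauge123`); the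
printed `z^{(k)}`, `z′^{(k)}` absorb the normalisations and are not computed (nor in print).  (b) (1.64) is printed for the Landau δ-function
integral (1.47); §4 states it for the `𝒢`-weighted integral of (1.23) = BIJ85's `Z_k(B)` (the two differ by a constant: p16's `B5Eq147FromEq123`
on the torus) — reading note, the exponent `½‖∂H_kB‖²` is the printed one.  (c) Linear (`𝔤 = ℝ`) fields as in Sect. 1 of the paper.
HONEST SCOPE: the torus-carrier statements of record are untouched; no bridge V1 ↔ `B5SectBStatements` is claimed; (1.25)–(1.26) (the explicit
minimiser `λ₀`) and (1.28) are not restated (tree: `B5GaussSectC`, `B5Infimum124`, …).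

Unit `lit-balaban-p38` (literature-prover-lit-balaban-p38-g3-0), 2026-08-21.
-/

open scoped BigOperators RealInnerProductSpace

namespace Literature.MathematicalPhysics.QuantumFieldTheory.Balaban1983to89

namespace B5Eq123ChangeOfGaugeV1

open LatticeFieldCalculus MeasureTheory Matrix B5Eq112RenormTransf B5Eq117CompositionV1 B5Eq119GaussianV1
open B5Eq120IterProof (bondAvgIter_grad bondAvgIter_gaugeShift_of_null)
open B5HierAxialGaugeV1 (hierAxial_exists kernel_trivial)
open Literature.MathematicalPhysics.QuantumFieldTheory.BalabanImbrieJaffe1984to88.BIJ85AxialPropagator411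
  (deltaAx constraint411 mem_constraint411 BondSpace toE V411 mem_V411)
open Literature.MathematicalPhysics.QuantumFieldTheory.BalabanImbrieJaffe1984to88.BIJ85LandauForm441
open Literature.MathematicalPhysics.QuantumFieldTheory.BalabanImbrieJaffe1984to88.BIJ85LandauMinimizer442
open Literature.MathematicalPhysics.QuantumFieldTheory.BalabanImbrieJaffe1984to88.BIJ85LandauMinimizer442V1

noncomputable section

variable {P : Params} {k : ℕ}

/-! ## 1. The three spaces of (1.23) on V1 and the slice ⊕ orbit coordinates of the fibre directions -/

/-- The Euclidean space of real site functions on the finest torus `T^{(0)}` (gauge functions `λ`). [folklore] -/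
abbrev SiteSpace (P : Params) : Type := EuclideanSpace ℝ (Site P 0)

variable (P) in
/-- **The residual gauge group `N(Q′_k) = {λ : Q′_kλ = 0}`** of (1.22)–(1.23) on V1, as a subspace of the Euclidean site-function space
(`Q′_k = siteAvgIter k`; it is the `kerQp` of every V1 instance `opsV1 P k c s` of [BalabanImbrieJaffe1985] Sect. 4.4, whatever `c`, `s`).
[cite: Balaban1984PropagatorsI, (1.22) p.21] -/
def resid (k : ℕ) : Submodule ℝ (SiteSpace P) := (opsV1 P k 1 1).kerQp

/-- Membership in `N(Q′_k)`: `Q′_kλ = 0`. [cite: Balaban1984PropagatorsI, (1.22) p.21] -/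
theorem mem_resid (l : SiteSpace P) : l ∈ resid P k ↔ siteAvgIter k (WithLp.ofLp l) = 0 := by
  rw [resid, LandauOps.mem_kerQp, opsV1_Qp]

/-- `N(Q′_k)` does not depend on the weights of the V1 instance. [folklore] -/
private theorem kerQp_eq_resid (c s : ℝ) : (opsV1 P k c s).kerQp = resid P k := rfl

variable (P) in
/-- **The fibre directions `N(Q_k) = {A : Q_kA = 0}`** — the direction space of the fibres `{Q_kA = B}` of `dA δ(B − Q_kA)` in (1.23)
(`Q_k = bondAvgIter k`; the `kerQk` of every `opsV1 P k c s`). [cite: Balaban1984PropagatorsI, (1.23) p.21] -/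
def fdir (k : ℕ) : Submodule ℝ (BondSpace P) := (opsV1 P k 1 1).kerQk

/-- Membership in `N(Q_k)`: `Q_kA = 0`. [cite: Balaban1984PropagatorsI, (1.23) p.21] -/
theorem mem_fdir (n : BondSpace P) : n ∈ fdir P k ↔ bondAvgIter k (WithLp.ofLp n) = 0 := by
  rw [fdir, LandauOps.mem_kerQk, opsV1_Qk]

/-- `N(Q_k)` does not depend on the weights of the V1 instance. [folklore] -/
private theorem kerQk_eq_fdir (c s : ℝ) : (opsV1 P k c s).kerQk = fdir P k := rfl

/-- Membership in the slice directions `V = {Q_kA = 0, δ_{k,Ax}(A)}` ([BalabanImbrieJaffe1985] (4.1.1), `V411`) in terms of the bond field.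
[cite: Balaban1984PropagatorsI, (1.17) p.20] -/
theorem mem_V411_iff (m : BondSpace P) : m ∈ V411 P k ↔ bondAvgIter k (WithLp.ofLp m) = 0 ∧ deltaAx k (WithLp.ofLp m) :=
  mem_V411 k m

variable (P) in
/-- `(m, λ) ↦ m − ∂λ`: slice direction and residual gauge parameter to a bond field. [cite: Balaban1984PropagatorsI, (1.23) p.21] -/
def phiFun (k : ℕ) (c : ℝ) : (↥(V411 P k) × ↥(resid P k)) →ₗ[ℝ] BondSpace P :=
  (V411 P k).subtype ∘ₗ LinearMap.fst ℝ _ _ - gradV1 P c ∘ₗ (resid P k).subtype ∘ₗ LinearMap.snd ℝ _ _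

/-- values of `phiFun`. [cite: Balaban1984PropagatorsI, (1.23) p.21] -/
theorem phiFun_apply (c : ℝ) (p : ↥(V411 P k) × ↥(resid P k)) :
    phiFun P k c p = (p.1 : BondSpace P) - gradV1 P c (p.2 : SiteSpace P) := rfl

/-- `m − ∂λ` is a fibre direction: `Q_k(m − ∂λ) = Q_km − ∂^{(k)}Q′_kλ = 0` ((1.20)). [cite: Balaban1984PropagatorsI, (1.20) p.20] -/
theorem phiFun_mem (hk : k ≤ P.m + P.K) (c : ℝ) (p : ↥(V411 P k) × ↥(resid P k)) : phiFun P k c p ∈ fdir P k := by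
  have hl : (opsV1 P k c 1).Qp (p.2 : SiteSpace P) = 0 := (LandauOps.mem_kerQp _).1 p.2.2
  rw [← kerQk_eq_fdir c 1, LandauOps.mem_kerQk, phiFun_apply, map_sub, (gaugeStructure_V1 hk c 1).Qk_grad _ hl,
    opsV1_Qk, ((mem_V411_iff _).1 p.1.2).1, sub_zero]


variable (P) in
/-- **The slice ⊕ orbit coordinates** `(m, λ) ↦ m − ∂λ` into the fibre directions `N(Q_k)`. [cite: Balaban1984PropagatorsI, (1.23) p.21] -/
def phi (hk : k ≤ P.m + P.K) (c : ℝ) : (↥(V411 P k) × ↥(resid P k)) →ₗ[ℝ] ↥(fdir P k) :=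
  LinearMap.codRestrict (fdir P k) (phiFun P k c) (phiFun_mem hk c)

/-- values of the coordinates. [cite: Balaban1984PropagatorsI, (1.23) p.21] -/
theorem phi_apply_coe (hk : k ≤ P.m + P.K) (c : ℝ) (p : ↥(V411 P k) × ↥(resid P k)) :
    (phi P hk c p : BondSpace P) = (p.1 : BondSpace P) - gradV1 P c (p.2 : SiteSpace P) := rfl

/-- `A^λ = A − ∂λ` as a difference of functions. [cite: Balaban1984PropagatorsI, (1.4) p.18] -/
theorem gaugeShift_eq_sub {j : ℕ} (c : ℝ) (lam : SiteField P j ℝ) (A : VecField P j ℝ) : gaugeShift c lam A = A - grad c lam := rfl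

/-- `A − ∂λ` in the Euclidean letters: `WithLp.ofLp (X − gradV1 c l) = (WithLp.ofLp X)^{WithLp.ofLp l}`. [cite: Balaban1984PropagatorsI, (1.4) p.18] -/
theorem ofLp_sub_gradV1 (c : ℝ) (X : BondSpace P) (l : SiteSpace P) :
    WithLp.ofLp (X - gradV1 P c l) = gaugeShift c (WithLp.ofLp l) (WithLp.ofLp X) := by
  rw [gradV1_apply, WithLp.ofLp_sub, WithLp.ofLp_toLp, gaugeShift_eq_sub]

/-- INJECTIVITY of the coordinates = uniqueness of the hierarchical axial gauge (`B5HierAxialGaugeV1.kernel_trivial`): a pure gauge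
`∂λ`, `λ ∈ N(Q′_k)`, all of whose averages `Q_j∂λ`, `j < k`, are axial is zero. [cite: Balaban1984PropagatorsI, (1.23) p.21] -/
theorem phi_injective (hk : k ≤ P.m + P.K) {c : ℝ} (hc : c ≠ 0) : Function.Injective (phi P hk c) := by
  rw [← LinearMap.ker_eq_bot, LinearMap.ker_eq_bot']
  rintro ⟨m, l⟩ h
  have h0 : (m : BondSpace P) - gradV1 P c (l : SiteSpace P) = 0 := by
    have h' := congrArg Subtype.val h
    rwa [phi_apply_coe] at h'
  have hml : WithLp.ofLp (m : BondSpace P) = grad c (WithLp.ofLp (l : SiteSpace P)) := by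
    have h1 := congrArg WithLp.ofLp (sub_eq_zero.mp h0)
    rwa [gradV1_apply, WithLp.ofLp_toLp] at h1
  have hax : ∀ j, j < k → IsAxial (bondAvgIter j (grad c (WithLp.ofLp (l : SiteSpace P)))) := by
    intro j hj
    rw [← hml]
    exact ((mem_V411_iff _).1 m.2).2 j hj
  have hl0 : WithLp.ofLp (l : SiteSpace P) = 0 := kernel_trivial hk hc ((mem_resid _).1 l.2) hax
  have hl : (l : SiteSpace P) = 0 := by simpa using congrArg (WithLp.toLp 2) hl0
  have hm : (m : BondSpace P) = 0 := by rw [sub_eq_zero.mp h0, hl, map_zero]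
  ext1
  · exact Subtype.ext hm
  · exact Subtype.ext hl

/-- SURJECTIVITY of the coordinates = existence of the hierarchical axial gauge (`B5HierAxialGaugeV1.hierAxial_exists`): every `n` with
`Q_kn = 0` is `n^{λ} − ∂(−λ)` with `n^λ` in the `k`-fold axial gauge and `Q_kn^λ = Q_kn = 0` ((1.20)). [cite: Balaban1984PropagatorsI, (1.23) p.21] -/
theorem phi_surjective (hk : k ≤ P.m + P.K) {c : ℝ} (hc : c ≠ 0) : Function.Surjective (phi P hk c) := by
  rintro ⟨n, hn⟩
  have hQn : bondAvgIter k (WithLp.ofLp n) = 0 := (mem_fdir n).1 hn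
  obtain ⟨lam, hlam, hax⟩ := hierAxial_exists hk hc (WithLp.ofLp n)
  have hm : WithLp.toLp 2 (gaugeShift c lam (WithLp.ofLp n)) ∈ V411 P k := by
    rw [mem_V411_iff, WithLp.ofLp_toLp, bondAvgIter_gaugeShift_of_null hk c hlam, hQn]
    exact ⟨rfl, hax⟩
  have hl : WithLp.toLp 2 lam ∈ resid P k := by rw [mem_resid, WithLp.ofLp_toLp, hlam]
  refine ⟨(⟨WithLp.toLp 2 (gaugeShift c lam (WithLp.ofLp n)), hm⟩, -⟨WithLp.toLp 2 lam, hl⟩), Subtype.ext ?_⟩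
  rw [phi_apply_coe]
  show WithLp.toLp 2 (gaugeShift c lam (WithLp.ofLp n)) - gradV1 P c (-(WithLp.toLp 2 lam)) = n
  rw [map_neg, sub_neg_eq_add, gradV1_apply, WithLp.ofLp_toLp, gaugeShift_eq_sub, WithLp.toLp_sub, sub_add_cancel,
    WithLp.toLp_ofLp]

variable (P) in
/-- **the coordinates as a continuous linear equivalence `V × N(Q′_k) ≃ N(Q_k)`** — the change of variables of (1.23) whose constant
Jacobian is `z^{(k)} → z′^{(k)}`. [cite: Balaban1984PropagatorsI, (1.23) p.21] -/
def coords (hk : k ≤ P.m + P.K) {c : ℝ} (hc : c ≠ 0) : (↥(V411 P k) × ↥(resid P k)) ≃L[ℝ] ↥(fdir P k) :=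
  (LinearEquiv.ofBijective (phi P hk c) ⟨phi_injective hk hc, phi_surjective hk hc⟩).toContinuousLinearEquiv

/-- values of the coordinates. [cite: Balaban1984PropagatorsI, (1.23) p.21] -/
theorem coords_apply_coe (hk : k ≤ P.m + P.K) {c : ℝ} (hc : c ≠ 0) (m : ↥(V411 P k)) (l : ↥(resid P k)) :
    (coords P hk hc (m, l) : BondSpace P) = (m : BondSpace P) - gradV1 P c (l : SiteSpace P) := by
  rw [coords, LinearEquiv.coe_toContinuousLinearEquiv', LinearEquiv.ofBijective_apply, phi_apply_coe]

/-! ## 2. The Faddeev–Popov integral of (1.22) on V1: it is the Gaussian integral (1.24) over `N(Q′_k)` and it is `> 0` -/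

section FaddeevPopov

open B5GaussSectC (gaussW ZN Rop calG)

/-- **The integral of (1.22) on V1**: `∫dλ δ(Q′_kλ) exp(−(1/2α)⟨∂*A^λ, ∂*A^λ⟩)` = the integral over the subspace `N(Q′_k)` (its Lebesgue =
volume measure, the reading (1.40) p. 25 of the constraint measure `dλ δ(Q′_kλ)`) of r18's Feynman-gauge form `divergenceForm w c α`
(`(1/2α)Σ_x w|(∂*A)(x)|²`, `w = η^d`, lattice factor `c = η⁻¹`) at the gauge transform `A^λ = A − ∂λ`. [cite: Balaban1984PropagatorsI, (1.22) p.21] -/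
def fp22 (k : ℕ) (w c α : ℝ) (A : VecField P 0 ℝ) : ℝ :=
  ∫ l : ↥(resid P k), Real.exp (-divergenceForm w c α (gaugeShift c (WithLp.ofLp (l : SiteSpace P)) A))

/-- The Feynman-gauge weight is a Gaussian weight of `∂*A`: `exp(−(1/2α)Σ_x w|(∂*A)(x)|²) = γ_{α/w}(∂*A)`, `γ_a(v) = e^{−‖v‖²/2a}`
(`B5GaussSectC.gaussW` on the Euclidean site-function space). [cite: Balaban1984PropagatorsI, (1.22) p.21] -/
theorem exp_neg_divergenceForm {w : ℝ} (hw : w ≠ 0) (c α : ℝ) (A : VecField P 0 ℝ) :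
    Real.exp (-divergenceForm w c α A) = gaussW (SiteSpace P) (α / w) (WithLp.toLp 2 (diverg c A)) := by
  rw [gaussW, divergenceForm, EuclideanSpace.norm_sq_eq]
  congr 1
  simp only [Real.norm_eq_abs, sq_abs, ← Finset.mul_sum]
  field_simp

/-- `∂*A^λ = ∂*A − Δλ` in the Euclidean letters, with the Laplacian of the V1 instance `opsV1 P k c 1`.
[cite: Balaban1984PropagatorsII, (2.8) p.224] -/
theorem toLp_diverg_gaugeShift (k : ℕ) (c : ℝ) (l : SiteSpace P) (A : VecField P 0 ℝ) :
    WithLp.toLp 2 (diverg c (gaugeShift c (WithLp.ofLp l) A)) = WithLp.toLp 2 (diverg c A) - (opsV1 P k c 1).lap l := by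
  rw [opsV1_lap, one_smul, diverg_gaugeShift, ← WithLp.toLp_sub]
  rfl

/-- (1.22)'s integral on V1 as the Gaussian integral of (1.24) over `N(Q′_k)`. [cite: Balaban1984PropagatorsI, (1.24) p.21] -/
theorem fp22_eq_gauss {w : ℝ} (hw : w ≠ 0) (c α : ℝ) (A : VecField P 0 ℝ) :
    fp22 k w c α A = ∫ l : ↥(resid P k),
      gaussW (SiteSpace P) (α / w) (WithLp.toLp 2 (diverg c A) - (opsV1 P k c 1).lap (l : SiteSpace P)) := by
  unfold fp22
  refine integral_congr_ae (ae_of_all _ fun l => ?_)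
  show Real.exp _ = gaussW _ _ _
  rw [exp_neg_divergenceForm hw, toLp_diverg_gaugeShift k]

/-- **«the operator Δ is positive definite on N(Q′_k), thus invertible»** (p. 25) on V1: `Δ` is injective on `N(Q′_k)`
(`BIJ85LandauMinimizer442V1.lapInjective_V1` ⟸ `B5Positivity172Lattice`). [cite: Balaban1984PropagatorsI, p.25] -/
theorem injOn_lap_resid (k : ℕ) {c : ℝ} (hc : c ≠ 0) : Set.InjOn ((opsV1 P k c 1).lap : SiteSpace P →ₗ[ℝ] SiteSpace P) (resid P k) := by
  rw [B5GaussSectC.injOn_iff]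
  intro x hx hΔ
  exact lapInjective_V1 k hc one_ne_zero x ((LandauOps.mem_kerQp _).1 hx) hΔ

/-- **(1.24) on V1**: `∫dλ δ(Q′_kλ) exp(−(1/2α)‖∂*A − Δλ‖²) = Z_N · exp(−(1/2α)‖∂*A − R∂*A‖²)` — the tree's `B5GaussSectC.integral_124`
(`Z_N = ∫_{N(Q′_k)} γ(Δλ)dλ`, `R` the orthogonal projection onto `ΔN(Q′_k)`), instantiated on the Euclidean site-function space of the torus.
[cite: Balaban1984PropagatorsI, (1.24) p.21] -/
theorem fp22_eq_124 {w : ℝ} (hw : w ≠ 0) (c α : ℝ) (A : VecField P 0 ℝ) :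
    fp22 k w c α A = ZN (resid P k) ((opsV1 P k c 1).lap : SiteSpace P →ₗ[ℝ] SiteSpace P) (α / w) *
      gaussW (SiteSpace P) (α / w) (WithLp.toLp 2 (diverg c A) -
        Rop (resid P k) ((opsV1 P k c 1).lap : SiteSpace P →ₗ[ℝ] SiteSpace P) (WithLp.toLp 2 (diverg c A))) := by
  rw [fp22_eq_gauss hw]
  exact B5GaussSectC.integral_124 (N := resid P k) (Δ := ((opsV1 P k c 1).lap : SiteSpace P →ₗ[ℝ] SiteSpace P)) _ _

/-- **(1.22) on V1, DISCHARGED: «we will see that it is different from 0»** — the Faddeev–Popov integral is `> 0` for every field, every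
`w > 0`, `α > 0`, lattice factor `c ≠ 0`, every level `k`. [cite: Balaban1984PropagatorsI, (1.22) p.21] -/
theorem fp22_pos (k : ℕ) {w : ℝ} (hw : 0 < w) {c : ℝ} (hc : c ≠ 0) {α : ℝ} (hα : 0 < α) (A : VecField P 0 ℝ) :
    0 < fp22 k w c α A := by
  rw [fp22_eq_124 hw.ne']
  exact mul_pos (B5GaussSectC.ZN_pos (injOn_lap_resid k hc) (div_pos hα hw)) (B5GaussSectC.gaussW_pos _ _)

/-- **(1.22) as displayed**, on V1: `1 = ∫dλ′ δ(Q′_kλ′)e^{−(1/2α)⟨∂*A^{λ′},∂*A^{λ′}⟩} / ∫dλ δ(Q′_kλ)e^{−(1/2α)⟨∂*A^λ,∂*A^λ⟩}`.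
[cite: Balaban1984PropagatorsI, (1.22) p.21] -/
theorem eq122 (k : ℕ) {w : ℝ} (hw : 0 < w) {c : ℝ} (hc : c ≠ 0) {α : ℝ} (hα : 0 < α) (A : VecField P 0 ℝ) :
    (1 : ℝ) = fp22 k w c α A / fp22 k w c α A :=
  (div_self (fp22_pos k hw hc hα A).ne').symm

/-- **(1.27) on V1**: `exp(−(1/2α)⟨∂*A,∂*A⟩)·(∫dλ δ(Q′_kλ)exp(−(1/2α)⟨∂*A^λ,∂*A^λ⟩))⁻¹ = 𝒢_α(∂*A)` with the tree's gauge-fixing density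
`B5GaussSectC.calG` (= `Z_N⁻¹ γ(R∂*A)`, (1.28)/(1.39)). [cite: Balaban1984PropagatorsI, (1.27) p.22] -/
theorem weight_eq_calG (k : ℕ) {w : ℝ} (hw : 0 < w) {c : ℝ} (hc : c ≠ 0) {α : ℝ} (hα : 0 < α) (A : VecField P 0 ℝ) :
    Real.exp (-divergenceForm w c α A) * (fp22 k w c α A)⁻¹ =
      calG (resid P k) ((opsV1 P k c 1).lap : SiteSpace P →ₗ[ℝ] SiteSpace P) (α / w) (WithLp.toLp 2 (diverg c A)) := by
  rw [exp_neg_divergenceForm hw.ne', fp22_eq_gauss hw.ne']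
  exact B5GaussSectC.calG_eq_127 (injOn_lap_resid k hc) (div_pos hα hw) _

/-- **p. 25 l. 1 on V1: «from its definition it follows that ∫dλ δ(Q′_kλ)𝒢_α(∂*A^λ) = 1»** — the orbit integral of the (1.23) weight
`e^{−(1/2α)⟨∂*A,∂*A⟩}(∫…)⁻¹` over `N(Q′_k)` equals `1`, for every `α > 0`. [cite: Balaban1984PropagatorsI, p.25 l.1] -/
theorem integral_weight_eq_one (k : ℕ) {w : ℝ} (hw : 0 < w) {c : ℝ} (hc : c ≠ 0) {α : ℝ} (hα : 0 < α) (A : VecField P 0 ℝ) :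
    ∫ l : ↥(resid P k), Real.exp (-divergenceForm w c α (gaugeShift c (WithLp.ofLp (l : SiteSpace P)) A)) *
      (fp22 k w c α (gaugeShift c (WithLp.ofLp (l : SiteSpace P)) A))⁻¹ = 1 := by
  have h : ∀ l : ↥(resid P k),
      Real.exp (-divergenceForm w c α (gaugeShift c (WithLp.ofLp (l : SiteSpace P)) A)) *
        (fp22 k w c α (gaugeShift c (WithLp.ofLp (l : SiteSpace P)) A))⁻¹ =
      calG (resid P k) ((opsV1 P k c 1).lap : SiteSpace P →ₗ[ℝ] SiteSpace P) (α / w)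
        (WithLp.toLp 2 (diverg c A) - (opsV1 P k c 1).lap (l : SiteSpace P)) := fun l => by
    rw [weight_eq_calG k hw hc hα, toLp_diverg_gaugeShift k]
  rw [integral_congr_ae (ae_of_all _ h)]
  exact B5GaussSectC.integral_calG_sub_Delta (injOn_lap_resid k hc) (div_pos hα hw) _

end FaddeevPopov


/-! ## 3. (1.23) on V1: the axial δ-functions of (1.17) traded for the Feynman-gauge weight, `z^{(k)} → z′^{(k)}` -/

section ChangeOfGauge

/-- `A ↦ S(A) = ½Σ_p w|(∂A)(p)|²` is continuous (a polynomial in the bond variables). [cite: Balaban1984PropagatorsI, (1.3) p.18] -/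
theorem continuous_curlAction (w c : ℝ) : Continuous fun A : VecField P 0 ℝ => curlAction w c A := by
  unfold curlAction curl
  refine continuous_const.mul (continuous_finsetSum _ fun p _ => continuous_const.mul ((Continuous.norm ?_).pow 2))
  fun_prop

/-- `A ↦ (1/2α)⟨∂*A, ∂*A⟩` is continuous (a polynomial in the bond variables). [cite: Balaban1984PropagatorsI, (1.22) p.21] -/
theorem continuous_divergenceForm (w c α : ℝ) : Continuous fun A : VecField P 0 ℝ => divergenceForm w c α A := by
  unfold divergenceForm diverg
  refine continuous_const.mul (continuous_finsetSum _ fun x _ => continuous_const.mul ((Continuous.norm ?_).pow 2))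
  exact continuous_finsetSum _ fun μ _ => by fun_prop

/-- **The gauge-fixing weight of (1.23)**: `e^{−(1/2α)⟨∂*A,∂*A⟩}·(∫dλ δ(Q′_kλ) e^{−(1/2α)⟨∂*A^λ,∂*A^λ⟩})⁻¹` (by (1.27) it is the density
`𝒢_α(∂*A)`, `weight_eq_calG`). [cite: Balaban1984PropagatorsI, (1.23) p.21] -/
def fpWeight (k : ℕ) (w c α : ℝ) (A : VecField P 0 ℝ) : ℝ :=
  Real.exp (-divergenceForm w c α A) * (fp22 k w c α A)⁻¹

/-- **The integral on the right-hand side of (1.23) on V1**: `∫dA δ(B − Q_kA) e^{−(1/2α)⟨∂*A,∂*A⟩}(∫dλ δ(Q′_kλ)e^{−(1/2α)⟨∂*A^λ,∂*A^λ⟩})⁻¹ ρ(A)`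
— the integral over the fibre `{Q_kA = B} = faceFieldIter k B + N(Q_k)` (volume measure of the subspace `N(Q_k)` of the Euclidean bond-field
space; base point the iterated section of `B5Eq117CompositionV1`, any other gives the same value: `rt23_eq_fibInt`) of the gauge-fixing weight
times the density `ρ` (`= e^{−S^η}` in print). [cite: Balaban1984PropagatorsI, (1.23) p.21] -/
def rt23 (k : ℕ) (w c α : ℝ) (ρ : VecField P 0 ℝ → ℝ) (B : VecField P k ℝ) : ℝ :=
  ∫ n : ↥(fdir P k), fpWeight k w c α (faceFieldIter k B + WithLp.ofLp (n : BondSpace P)) *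
    ρ (faceFieldIter k B + WithLp.ofLp (n : BondSpace P))

/-- `Q_k` of the iterated section, in the letters of the V1 instance: `Q_k(faceFieldIter k B) = B`. [cite: Balaban1984PropagatorsI, (1.17) p.20] -/
theorem Qk_toLp_faceFieldIter (hk : k ≤ P.m + P.K) (c s : ℝ) (B : VecField P k ℝ) :
    (opsV1 P k c s).Qk (WithLp.toLp 2 (faceFieldIter k B)) = B := by
  rw [opsV1_Qk, WithLp.ofLp_toLp, bondAvgIter_faceFieldIter hk]

/-- **BASE-POINT INDEPENDENCE / dictionary with [BalabanImbrieJaffe1985] (4.4.3)**: the (1.23) integral is the constrained integral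
`∫𝒟A δ(Q_kA − B)(…)` of `BIJ85LandauMinimizer442.fibInt` for the V1 instance `opsV1 P k c s` (any weights `s`), whose value does not depend on the
base point of the fibre (`fibInt_eq_of_mem`). [cite: Balaban1984PropagatorsI, (1.23) p.21] -/
theorem rt23_eq_fibInt (hk : k ≤ P.m + P.K) (w c α s : ℝ) (ρ : VecField P 0 ℝ → ℝ) (B : VecField P k ℝ) :
    rt23 k w c α ρ B = fibInt (opsV1 P k c s) (fun X => fpWeight k w c α (WithLp.ofLp X) * ρ (WithLp.ofLp X)) B := by
  rw [fibInt_eq_of_mem (opsV1 P k c s) _ (Qk_toLp_faceFieldIter hk c s B)]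
  simp only [WithLp.ofLp_add]
  rfl

/-- The right-hand side of (1.17) (`multiRT`, coordinates of the `k`-fold constraint space) as the volume integral over BIJ85's `V`, in the
Euclidean letters. [cite: Balaban1984PropagatorsI, (1.17) p.20] -/
theorem multiRT_eq_integral (k : ℕ) (ρ : VecField P 0 ℝ → ℝ) (B : VecField P k ℝ) :
    multiRT k ρ B = ∫ m : ↥(V411 P k), ρ (WithLp.ofLp (WithLp.toLp 2 (faceFieldIter k B) + (m : BondSpace P))) := by
  rw [B5Eq117FibreVolume.multiRT_eq_integral_V411]
  rfl

/-- **(1.23) ON THE V1 CALCULUS — the change of gauge, `z^{(k)} → z′^{(k)}`.**  In the standing range `k ≤ m + K`, lattice factor `c ≠ 0`: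
there is ONE constant `z > 0` (the Jacobian of the slice ⊕ orbit coordinates `coords`; it depends on nothing else) such that for every
volume weight `w > 0`, every `α > 0`, every continuous density `ρ ≥ 0` invariant under the restricted gauge transformations `A ↦ A^λ`,
`λ ∈ N(Q′_k)` (print: «all the expressions in the integral (1.17) with the exception of gauge fixing terms δ_Ax are invariant»), and every `B`:
`∫dA δ(B − Q_kA)δ_Ax(Q_{k−1}A)⋯δ_Ax(A) ρ(A) = z · ∫dA δ(B − Q_kA) e^{−(1/2α)⟨∂*A,∂*A⟩}(∫dλ δ(Q′_kλ)e^{−(1/2α)⟨∂*A^λ,∂*A^λ⟩})⁻¹ρ(A)`.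
Proof = the printed one, through p22's kernel of it (`B5ChangeOfGauge123.eq123_zprime`: insert (1.22), change the order of integrations, gauge
transformation `−λ′`, change the order again, translation `λ → λ + λ′`), fed with the V1 coordinates of §1 and (1.22) `≠ 0` of §2.
[cite: Balaban1984PropagatorsI, (1.23) p.21] -/
theorem multiRT_eq_rt23 (hk : k ≤ P.m + P.K) {c : ℝ} (hc : c ≠ 0) :
    ∃ z : ℝ, 0 < z ∧ ∀ {w α : ℝ}, 0 < w → 0 < α → ∀ (ρ : VecField P 0 ℝ → ℝ), (∀ A, 0 ≤ ρ A) → Continuous ρ →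
      (∀ (lam : SiteField P 0 ℝ) (A : VecField P 0 ℝ), siteAvgIter k lam = 0 → ρ (gaugeShift c lam A) = ρ A) →
      ∀ B : VecField P k ℝ, multiRT k ρ B = z * rt23 k w c α ρ B := by
  haveI : ((volume : Measure ↥(V411 P k)).prod (volume : Measure ↥(resid P k))).IsAddHaarMeasure :=
    Measure.prod.instIsAddHaarMeasure _ _
  have he : ∀ (m : ↥(V411 P k)) (l : ↥(resid P k)), (fdir P k).subtype (coords P hk hc (m, l)) =
      (V411 P k).subtype m - (gradV1 P c ∘ₗ (resid P k).subtype) l := fun m l => by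
    rw [Submodule.subtype_apply, coords_apply_coe]; rfl
  obtain ⟨z, hz, h⟩ := B5ChangeOfGauge123.eq123_zprime (volume : Measure ↥(V411 P k)) (volume : Measure ↥(resid P k))
    (volume : Measure ↥(fdir P k)) (coords P hk hc) (V411 P k).subtype (fdir P k).subtype
    (gradV1 P c ∘ₗ (resid P k).subtype) he
  refine ⟨z, hz, fun {w α} hw hα ρ hρ0 hρc hρinv B => ?_⟩
  -- the data of (1.23): base point, gauge-fixing weight, invariant density
  set a : BondSpace P := WithLp.toLp 2 (faceFieldIter k B) with ha
  obtain ⟨g, hg⟩ : ∃ g : BondSpace P → ℝ, ∀ X, g X = Real.exp (-divergenceForm w c α (WithLp.ofLp X)) :=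
    ⟨fun X => Real.exp (-divergenceForm w c α (WithLp.ofLp X)), fun _ => rfl⟩
  obtain ⟨ρ', hρ'⟩ : ∃ ρ' : BondSpace P → ℝ, ∀ X, ρ' X = ρ (WithLp.ofLp X) := ⟨fun X => ρ (WithLp.ofLp X), fun _ => rfl⟩
  have hgc : Continuous g := by
    rw [show g = fun X => Real.exp (-divergenceForm w c α (WithLp.ofLp X)) from funext hg]
    exact Real.continuous_exp.comp ((continuous_divergenceForm w c α).comp (PiLp.continuous_ofLp 2 _)).neg
  have hρ'c : Continuous ρ' := by
    rw [show ρ' = fun X => ρ (WithLp.ofLp X) from funext hρ']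
    exact hρc.comp (PiLp.continuous_ofLp 2 _)
  have hD : ∀ l : ↥(resid P k), (gradV1 P c ∘ₗ (resid P k).subtype) l = gradV1 P c (l : SiteSpace P) := fun l => rfl
  -- the orbit integral of `g` through a point `X` is (1.22)'s integral at `X`
  have horbit : ∀ X : BondSpace P, ∫ l : ↥(resid P k), g (X - (gradV1 P c ∘ₗ (resid P k).subtype) l) =
      fp22 k w c α (WithLp.ofLp X) := fun X => by
    unfold fp22
    refine integral_congr_ae (ae_of_all _ fun l => ?_)
    show g _ = Real.exp _
    rw [hg, hD, ofLp_sub_gradV1]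
  have h1 := h a g ρ' 1 (fun X => by rw [hg]; exact (Real.exp_pos _).le) (fun X => by rw [hρ']; exact hρ0 _)
    ((hgc.comp (((continuous_const.add continuous_subtype_val).comp continuous_fst).sub
      ((gradV1 P c ∘ₗ (resid P k).subtype).continuous_of_finiteDimensional.comp continuous_snd))).aestronglyMeasurable)
    ((hρ'c.comp (continuous_const.add continuous_subtype_val)).aestronglyMeasurable)
    (fun m l => by rw [hρ', hρ', hD, ofLp_sub_gradV1, hρinv _ _ ((mem_resid _).1 l.2)])
    (fun m => by rw [horbit]; exact (fp22_pos k hw hc hα _).ne')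
  rw [one_mul, one_mul] at h1
  -- read off the two sides
  rw [multiRT_eq_integral, rt23]
  simp only [Submodule.subtype_apply, hρ'] at h1
  rw [h1]
  congr 1
  refine integral_congr_ae (ae_of_all _ fun n => ?_)
  show g _ * _ * _ = fpWeight k w c α _ * _
  rw [horbit, hg, fpWeight, ha, WithLp.ofLp_add, WithLp.ofLp_toLp]

end ChangeOfGauge


/-! ## 4. (1.23) for `(ST)^k e^{−S}`; α-independence; B5 (1.17)/(1.23) = [BalabanImbrieJaffe1985] (4.4.3) `Z_k(B)`; (1.64) on V1 -/

section Consequences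

/-- **(1.23) AS PRINTED, on the V1 calculus.**  For the abelian action `S^η(A) = ½Σ_p w|(∂A)(p)|²` (`curlAction w c`, volume weight `w = η^d > 0`,
lattice factor `c = η⁻¹ ≠ 0`) and every `k` in the standing range there is ONE `z′^{(k)} > 0` with
`((ST)^k e^{−S})(B) = z′^{(k)} ∫dA δ(B − Q_kA) exp(−(1/2α)⟨∂*A,∂*A⟩)·(∫dλ δ(Q′_kλ) exp(−(1/2α)⟨∂*A^λ,∂*A^λ⟩))⁻¹ e^{−S^η(A)}`
for EVERY `α > 0` and EVERY `B` — `(ST)^k` = the `k`-fold iterate `rtPow` of p16's (1.12) transformation `B5Eq112RenormTransf.renormTransf`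
(so `z′^{(k)} = z^{(k)}·c`: gen-2's (1.17) `B5Eq117CompositionV1.eq117_curlAction` times the Jacobian of `multiRT_eq_rt23`).
[cite: Balaban1984PropagatorsI, (1.23) p.21] -/
theorem eq123 (hk : k ≤ P.m + P.K) {w : ℝ} (hw : 0 < w) {c : ℝ} (hc : c ≠ 0) :
    ∃ z' : ℝ, 0 < z' ∧ ∀ {α : ℝ}, 0 < α → ∀ B : VecField P k ℝ,
      rtPow k (fun A => Real.exp (-curlAction w c A)) B = z' * rt23 k w c α (fun A => Real.exp (-curlAction w c A)) B := by
  obtain ⟨z, hz, h117⟩ := eq117_curlAction (P := P) hk hw hc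
  obtain ⟨z₁, hz₁, h123⟩ := multiRT_eq_rt23 (P := P) hk hc
  refine ⟨z * z₁, mul_pos hz hz₁, fun {α} hα B => ?_⟩
  have hc' : Continuous fun A : VecField P 0 ℝ => Real.exp (-curlAction w c A) :=
    Real.continuous_exp.comp (continuous_curlAction w c).neg
  rw [h117 B, h123 hw hα (fun A => Real.exp (-curlAction w c A)) (fun A => (Real.exp_pos _).le) hc'
    (fun lam A _ => by rw [curlAction_gaugeShift]) B, mul_assoc]

/-- **The (1.23) integral does not depend on `α`** (the content of p. 25 l. 1 «∫dλ δ(Q′_kλ)𝒢_α(∂*A^λ) = 1» / of the limit (1.41) → (1.46) at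
the level of (1.23); torus twin `B5Eq147FromEq123.rt23_eq_rt23`): for every admissible density `ρ` and all `α, α′ > 0`,
`rt23 k w c α ρ B = rt23 k w c α′ ρ B`. [cite: Balaban1984PropagatorsI, (1.23) p.21] -/
theorem rt23_eq_rt23 (hk : k ≤ P.m + P.K) {w : ℝ} (hw : 0 < w) {c : ℝ} (hc : c ≠ 0) {α α' : ℝ} (hα : 0 < α) (hα' : 0 < α')
    (ρ : VecField P 0 ℝ → ℝ) (hρ0 : ∀ A, 0 ≤ ρ A) (hρc : Continuous ρ)
    (hρinv : ∀ (lam : SiteField P 0 ℝ) (A : VecField P 0 ℝ), siteAvgIter k lam = 0 → ρ (gaugeShift c lam A) = ρ A)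
    (B : VecField P k ℝ) : rt23 k w c α ρ B = rt23 k w c α' ρ B := by
  obtain ⟨z, hz, h⟩ := multiRT_eq_rt23 (P := P) hk hc
  have h1 := h hw hα ρ hρ0 hρc hρinv B
  have h2 := h hw hα' ρ hρ0 hρc hρinv B
  exact mul_left_cancel₀ hz.ne' (h1.symm.trans h2)

/-- **DICTIONARY: the (1.23) weight IS the (4.4.1)–(4.4.3) weight of [BalabanImbrieJaffe1985].**  For the V1 instance `opsV1 P k c s` of
Sect. 4.4 (`∂ = s·curl c`, `∂* = s·diverg c`, `Δ = s·laplace c`; BIJ85 normalisation `α = 1`, both quadratic forms weighted by `s²`):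
`e^{−½⟨∂*A,∂*A⟩}(∫dλ δ(Q′_kλ)e^{−½⟨∂*A^λ,∂*A^λ⟩})⁻¹·e^{−S(A)} = 𝒢(∂*A)e^{−½‖∂A‖²}` (`BIJ85LandauMinimizer442.weight`), `w = s²`.
[cite: BalabanImbrieJaffe1985, (4.4.1) p.311] -/
theorem fpWeight_mul_exp_eq_weight (k : ℕ) (c s : ℝ) (X : BondSpace P) :
    fpWeight k (s ^ 2) c 1 (WithLp.ofLp X) * Real.exp (-curlAction (s ^ 2) c (WithLp.ofLp X)) = weight (opsV1 P k c s) X := by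
  have hsq : ∀ v : SiteSpace P, (1 / 2 : ℝ) * ‖s • v‖ ^ 2 = (1 / (2 * 1)) * ∑ x : Site P 0, s ^ 2 * ‖v x‖ ^ 2 := fun v => by
    rw [norm_smul, mul_pow, Real.norm_eq_abs, sq_abs, EuclideanSpace.norm_sq_eq, Finset.mul_sum]
    ring
  have hdiv : ∀ A : VecField P 0 ℝ, (1 / 2 : ℝ) * ‖(opsV1 P k c s).dstar (WithLp.toLp 2 A)‖ ^ 2 = divergenceForm (s ^ 2) c 1 A :=
    fun A => by rw [opsV1_dstar, WithLp.ofLp_toLp, hsq, divergenceForm]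
  have hden : fpDen (opsV1 P k c s) ((opsV1 P k c s).dstar X) = fp22 k (s ^ 2) c 1 (WithLp.ofLp X) := by
    unfold fpDen fp22
    refine integral_congr_ae (ae_of_all _ fun l => ?_)
    show Real.exp _ = Real.exp _
    congr 1
    rw [neg_mul, neg_inj, ← hdiv, opsV1_dstar, opsV1_dstar, opsV1_lap, ← smul_sub, ← WithLp.toLp_sub, WithLp.ofLp_toLp,
      diverg_gaugeShift]
    rfl
  have hcurl : (1 / 2 : ℝ) * ‖(opsV1 P k c s).curl X‖ ^ 2 = curlAction (s ^ 2) c (WithLp.ofLp X) := by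
    rw [opsV1_curl, norm_smul, mul_pow, Real.norm_eq_abs, sq_abs, EuclideanSpace.norm_sq_eq, curlAction, Finset.mul_sum]
  rw [weight, calG, fpWeight, hden, ← hdiv, WithLp.toLp_ofLp, ← hcurl, neg_mul, neg_mul,
    div_eq_mul_inv (Real.exp _) (fp22 k (s ^ 2) c 1 (WithLp.ofLp X))]

/-- **B5 (1.23) integral = [BalabanImbrieJaffe1985] (4.4.3) `Z_k(B)`** on V1: for the instance `opsV1 P k c s`,
`∫dA δ(B − Q_kA) e^{−½⟨∂*A,∂*A⟩}(∫dλ δ(Q′_kλ)e^{−½⟨∂*A^λ,∂*A^λ⟩})⁻¹ e^{−S(A)} = Z_k(B) = ∫𝒟A δ(Q_kA − B)𝒢(∂*A)e^{−½‖∂A‖²}`.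
[cite: BalabanImbrieJaffe1985, (4.4.3) p.312] -/
theorem rt23_eq_Zk (hk : k ≤ P.m + P.K) (c s : ℝ) (B : VecField P k ℝ) :
    rt23 k (s ^ 2) c 1 (fun A => Real.exp (-curlAction (s ^ 2) c A)) B = Zk (opsV1 P k c s) B := by
  rw [Zk, rt23_eq_fibInt hk (s ^ 2) c 1 s]
  simp only [fpWeight_mul_exp_eq_weight]

/-- **B5 (1.17)/(1.23) = `z′^{(k)}`·[BalabanImbrieJaffe1985] (4.4.3)** on the V1 calculus: `((ST)^k e^{−S})(B) = z′^{(k)}·Z_k(B)` with ONE `z′^{(k)} > 0` for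
all `B` (`S = ½Σ_p s²|(∂A)(p)|²`, `k ≤ m + K`, `c ≠ 0`, `s ≠ 0`) — the Landau-type (Faddeev–Popov weighted) companion of gen-2's axial statement
`B5Eq117FibreVolume.eq117_torusZax` (`((ST)^k e^{−S})(B) = z^{(k)}·Z_{k,Ax}(B)`, (4.1.4)). [cite: Balaban1984PropagatorsI, (1.23) p.21] -/
theorem eq123_Zk (hk : k ≤ P.m + P.K) {c : ℝ} (hc : c ≠ 0) {s : ℝ} (hs : s ≠ 0) :
    ∃ z' : ℝ, 0 < z' ∧ ∀ B : VecField P k ℝ, rtPow k (fun A => Real.exp (-curlAction (s ^ 2) c A)) B = z' * Zk (opsV1 P k c s) B := by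
  obtain ⟨z', hz', h⟩ := eq123 (P := P) hk (by positivity : (0 : ℝ) < s ^ 2) hc
  exact ⟨z', hz', fun B => by rw [h one_pos B, rt23_eq_Zk hk]⟩

/-- **(1.64) on V1, for the (1.23)-weighted integral**: p. 29 «We make the translation A = A′ + H_kB and using the above properties of H_kB,
we get (1.47) = Z_k exp(−½⟨∂H_kB, ∂H_kB⟩). (1.64)» — here for the `k`-fold integral in the Feynman-type gauge of (1.23) (BIJ85's `Z_k(B)`, the
Landau δ-function `δ_R` of (1.47) replaced by its Gaussian regularisation `𝒢`, which changes only the constant — reading note): there is ONE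
constant `C > 0` with `Z_k(B) = C·exp(−½‖∂H_kB‖²)` for all `B`, `H_kB` the Landau-gauge minimizer of (1.58)–(1.63) = (4.4.2) on V1 (seat p11);
obtained from (1.19) on V1 (`B5Eq119GaussianV1.eq119`) and the equality of the axial and Landau exponents (1.65) (`B5Eq165GaugeMinimaV1.eq165_landau`).
[cite: Balaban1984PropagatorsI, (1.64) p.29] -/
theorem Zk_eq_exp (hk : k ≤ P.m + P.K) {c : ℝ} (hc : c ≠ 0) {s : ℝ} (hs : s ≠ 0) :
    ∃ C : ℝ, 0 < C ∧ ∀ B : VecField P k ℝ,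
      Zk (opsV1 P k c s) B = C * Real.exp (-(1 / 2 : ℝ) * ‖(opsV1 P k c s).curl (Hk (opsV1 P k c s) B)‖ ^ 2) := by
  have hw : (0 : ℝ) < s ^ 2 := by positivity
  obtain ⟨z', hz', h⟩ := eq123_Zk (P := P) hk hc hs
  refine ⟨zAx P k (s ^ 2) c / z', div_pos (zAx_pos hk hw hc) hz', fun B => ?_⟩
  have h1 := h B
  rw [eq119 hk hw hc B, neg_mul] at h1
  rw [neg_mul, B5Eq165GaugeMinimaV1.eq165_landau hk hc hs B, div_mul_eq_mul_div, eq_div_iff hz'.ne', mul_comm _ z', h1]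

/-- **Z_{k,Ax}(B) and Z_k(B) are proportional**: the axial ((4.1.4), `BIJ85AxialMinimizer413.torusZax`) and the Landau-type ((4.4.3), `Zk`) fibre
integrals of [BalabanImbrieJaffe1985] over `{Q_kA = B}` differ by a `B`-independent factor — the V1 statement of «(1.17) = (1.23)» between the two
gauges. [cite: Balaban1984PropagatorsI, (1.23) p.21] -/
theorem torusZax_eq_const_mul_Zk (hk : k ≤ P.m + P.K) {c : ℝ} (hc : c ≠ 0) {s : ℝ} (hs : s ≠ 0) :
    ∃ C : ℝ, 0 < C ∧ ∀ B : VecField P k ℝ,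
      Literature.MathematicalPhysics.QuantumFieldTheory.BalabanImbrieJaffe1984to88.BIJ85AxialMinimizer413.torusZax (s ^ 2) c k
        (faceFieldIter k B) = C * Zk (opsV1 P k c s) B := by
  have hw : (0 : ℝ) < s ^ 2 := by positivity
  obtain ⟨z, hz, h117⟩ := B5Eq117FibreVolume.eq117_torusZax (P := P) hk hw hc
  obtain ⟨z', hz', h123⟩ := eq123_Zk (P := P) hk hc hs
  refine ⟨z' / z, div_pos hz' hz, fun B => ?_⟩
  have h1 := (h117 B).symm.trans (h123 B)
  rw [div_mul_eq_mul_div, eq_div_iff hz.ne', mul_comm _ z, h1]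

end Consequences

end

end B5Eq123ChangeOfGaugeV1

end Literature.MathematicalPhysics.QuantumFieldTheory.Balaban1983to89
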